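import Summits.Ventures.LatticeQCDFlow.Scaling.WarmStartPerfect

/-!
HONEST FRAMING: exact (Metropolis-corrected) sampling algorithms for lattice gauge theory; figures
of merit are autocorrelation/cost numbers at stated couplings and volumes; no continuum-physics
claim.

# WarmStartUniformListing — THE WARM START AT UNIFORM LISTING `m = cK`: AFTER PERTURBING THE REPLICAS OF `D₀` OF AN
# EQUILIBRATED MAP-ASSISTED HUB, `‖λ₀Pⁿ − π̃‖_TV ≤ ((2#(D₀∖0) + p𝟙{0∈D₀})/p)·(1 − tp/(2K))ⁿ`, I.E. `ε`-CLOSE AFTER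
# `(2K/(tp))·log((2#(D₀∖0) + p𝟙{0∈D₀})/(pε))` STEPS; PERFECT MAPS: `2#D₀·(1 − t(1−t)w_0/(2K))ⁿ` (lean-2 GEN-26, ours)

Venture-side (OURS).  Cell `lqcd-flow` (pub-lqcd), unit `pub-lqcd-lean-2-g26`, 2026-08-27.  Chapter M, file 31 — the
constants of `Scaling/WarmStartCeiling` / `Scaling/WarmStartPerfect` at the natural operating point `m = cK`.

## What is proved

* **`uniformWarmStart_tvDist_le`**, **`uniformWarmStart_tvDist_le_of_ge_log`** — one-sided domination `p`,
  `4t ≤ p(1−t)w_0`, `m = cK`; **`uniformWarmStart_perfect_tvDist_le`** — perfect transports, `m = cK`.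

NOT CLAIMED: anything measured.  Literature grade (cell rule): OWN COROLLARY; nothing cited as a fact; no new bib keys.
-/

noncomputable section

open Finset Function
open Literature.Probability.MarkovChains

namespace Summit.Ventures.LatticeQCDFlow.Scaling

variable {S : Type*} [Fintype S] [DecidableEq S] {K m : ℕ} {μ : Fin (K + 1) → S → ℝ} {M : Fin (K + 1) → S → S → ℝ}
  {w : Fin (K + 1) → ℝ} {t p : ℝ}

section UniformWarm
variable (κ : Fin m → Fin K) (φ : Fin m → Equiv.Perm S)

/-- **THE WARM START AT `m = cK`: `‖λ₀Pⁿ − π̃‖_TV ≤ ((2#(D₀∖0) + p𝟙{0∈D₀})/p)·(1 − tp/(2K))ⁿ`.** [ours] -/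
theorem uniformWarmStart_tvDist_le (ht0 : 0 ≤ t) (ht1 : t ≤ 1) (hw0 : ∀ k, 0 ≤ w k) (hw1 : ∑ k, w k = 1)
    (hμ : ∀ k x, 0 < μ k x) (hμ1 : ∀ k, ∑ u, μ k u = 1) (hM : ∀ k, IsRowStochastic (M k))
    (hM0 : ∀ u v, M 0 u v = μ 0 v) (hstat : ∀ k : Fin (K + 1), k ≠ 0 → ∀ v, ∑ u, μ k u * M k u v = μ k v)
    (hp0 : 0 < p) (hp1 : p ≤ 1) (hdom : ∀ r u, p * μ (κ r).succ (φ r u) ≤ μ 0 u) (hreg : 4 * t ≤ p * (1 - t) * w 0)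
    {c : ℕ} (hc1 : 1 ≤ c) (hK : 1 ≤ K) (hc : ∀ p' : Fin K, c ≤ (univ.filter (fun r : Fin m => κ r = p')).card)
    (hmc : m = c * K) (D₀ : Finset (Fin (K + 1))) (x : Fin (K + 1) → S)
    {g : Fin (K + 1) → S → ℝ} (hg' : ∀ j u, g j u = if j ∈ D₀ then (if u = x j then (1 : ℝ) else 0) else μ j u)
    (n : ℕ) :
    tvDist (lawAt (fun y z : Fin (K + 1) → S =>
          t * ptGraphSwap μ (fun r : Fin m => (((0 : Fin (K + 1)), (κ r).succ) : Fin (K + 1) × Fin (K + 1))) φ y z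
          + (1 - t) * prodKernel w M y z) (tensorFun g) n) (tensorFun μ)
      ≤ (2 * ((D₀.erase 0).card : ℝ) + p * (if (0 : Fin (K + 1)) ∈ D₀ then (1 : ℝ) else 0)) / p
          * (1 - t * p / (2 * K)) ^ n := by
  have hm : 1 ≤ m := by rw [hmc]; exact Nat.one_le_iff_ne_zero.mpr (Nat.mul_ne_zero (by omega) (by omega))
  have hcm : c ≤ m := by rw [hmc]; exact Nat.le_mul_of_pos_right c (by omega)
  have h := warmStart_tvDist_le κ φ hm ht0 ht1 hw0 hw1 hμ hμ1 hM hM0 hstat hp0 hp1 hdom hreg hc1 hc hcm D₀ x hg' n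
  have hcpos : (0 : ℝ) < c := Nat.cast_pos.mpr (by omega)
  have hmR : (m : ℝ) = c * K := by rw [hmc, Nat.cast_mul]
  have e : t * c * p / (2 * (m : ℝ)) = t * p / (2 * K) := by rw [hmR]; field_simp
  rwa [e] at h

/-- **`ε`-CLOSE AFTER `(2K/(tp))·log((2#(D₀∖0) + p𝟙{0∈D₀})/(pε))` STEPS** at `m = cK` (`0 < t`, `D₀` non-empty). [ours] -/
theorem uniformWarmStart_tvDist_le_of_ge_log (ht0 : 0 < t) (ht1 : t ≤ 1) (hw0 : ∀ k, 0 ≤ w k) (hw1 : ∑ k, w k = 1)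
    (hμ : ∀ k x, 0 < μ k x) (hμ1 : ∀ k, ∑ u, μ k u = 1) (hM : ∀ k, IsRowStochastic (M k))
    (hM0 : ∀ u v, M 0 u v = μ 0 v) (hstat : ∀ k : Fin (K + 1), k ≠ 0 → ∀ v, ∑ u, μ k u * M k u v = μ k v)
    (hp0 : 0 < p) (hp1 : p ≤ 1) (hdom : ∀ r u, p * μ (κ r).succ (φ r u) ≤ μ 0 u) (hreg : 4 * t ≤ p * (1 - t) * w 0)
    {c : ℕ} (hc1 : 1 ≤ c) (hK : 1 ≤ K) (hc : ∀ p' : Fin K, c ≤ (univ.filter (fun r : Fin m => κ r = p')).card)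
    (hmc : m = c * K) (D₀ : Finset (Fin (K + 1))) (hD₀ : D₀.Nonempty) (x : Fin (K + 1) → S)
    {g : Fin (K + 1) → S → ℝ} (hg' : ∀ j u, g j u = if j ∈ D₀ then (if u = x j then (1 : ℝ) else 0) else μ j u)
    {ε : ℝ} (hε : 0 < ε) {n : ℕ}
    (hn : 2 * (K : ℝ) / (t * p)
      * Real.log ((2 * ((D₀.erase 0).card : ℝ) + p * (if (0 : Fin (K + 1)) ∈ D₀ then (1 : ℝ) else 0)) / (p * ε)) ≤ n) :
    tvDist (lawAt (fun y z : Fin (K + 1) → S =>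
          t * ptGraphSwap μ (fun r : Fin m => (((0 : Fin (K + 1)), (κ r).succ) : Fin (K + 1) × Fin (K + 1))) φ y z
          + (1 - t) * prodKernel w M y z) (tensorFun g) n) (tensorFun μ) ≤ ε := by
  have hm : 1 ≤ m := by rw [hmc]; exact Nat.one_le_iff_ne_zero.mpr (Nat.mul_ne_zero (by omega) (by omega))
  have hcm : c ≤ m := by rw [hmc]; exact Nat.le_mul_of_pos_right c (by omega)
  have hcpos : (0 : ℝ) < c := Nat.cast_pos.mpr (by omega)
  have hmR : (m : ℝ) = c * K := by rw [hmc, Nat.cast_mul]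
  have e : 2 * (m : ℝ) / (t * c * p) = 2 * K / (t * p) := by rw [hmR]; field_simp
  refine warmStart_tvDist_le_of_ge_log κ φ hm ht0 ht1 hw0 hw1 hμ hμ1 hM hM0 hstat hp0 hp1 hdom hreg hc1 hc hcm D₀ hD₀ x
    hg' hε ?_
  rw [e]; exact hn

/-- **THE PERFECT-TRANSPORT WARM START AT `m = cK`: `‖λ₀Pⁿ − π̃‖_TV ≤ 2#D₀·(1 − t(1−t)w_0/(2K))ⁿ`.** [ours] -/
theorem uniformWarmStart_perfect_tvDist_le (ht0 : 0 < t) (ht1 : t < 1) (hw0 : ∀ k, 0 ≤ w k) (hw00 : 0 < w 0)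
    (hw1 : ∑ k, w k = 1) (hμ : ∀ k x, 0 < μ k x) (hμ1 : ∀ k, ∑ u, μ k u = 1) (hM : ∀ k, IsRowStochastic (M k))
    (hM0 : ∀ u v, M 0 u v = μ 0 v) (hstat : ∀ k : Fin (K + 1), k ≠ 0 → ∀ v, ∑ u, μ k u * M k u v = μ k v)
    (hperf : ∀ r u, μ (κ r).succ (φ r u) = μ 0 u)
    {c : ℕ} (hc1 : 1 ≤ c) (hK : 1 ≤ K) (hc : ∀ p' : Fin K, c ≤ (univ.filter (fun r : Fin m => κ r = p')).card)
    (hmc : m = c * K) (D₀ : Finset (Fin (K + 1))) (x : Fin (K + 1) → S)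
    {g : Fin (K + 1) → S → ℝ} (hg' : ∀ j u, g j u = if j ∈ D₀ then (if u = x j then (1 : ℝ) else 0) else μ j u)
    (n : ℕ) :
    tvDist (lawAt (fun y z : Fin (K + 1) → S =>
          t * ptGraphSwap μ (fun r : Fin m => (((0 : Fin (K + 1)), (κ r).succ) : Fin (K + 1) × Fin (K + 1))) φ y z
          + (1 - t) * prodKernel w M y z) (tensorFun g) n) (tensorFun μ)
      ≤ 2 * (D₀.card : ℝ) * (1 - t * (1 - t) * w 0 / (2 * K)) ^ n := by
  have hm : 1 ≤ m := by rw [hmc]; exact Nat.one_le_iff_ne_zero.mpr (Nat.mul_ne_zero (by omega) (by omega))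
  have hcm : c ≤ m := by rw [hmc]; exact Nat.le_mul_of_pos_right c (by omega)
  have h := warmStart_perfect_tvDist_le κ φ hm ht0 ht1 hw0 hw00 hw1 hμ hμ1 hM hM0 hstat hperf hc1 hc hcm D₀ x hg' n
  have hcpos : (0 : ℝ) < c := Nat.cast_pos.mpr (by omega)
  have hmR : (m : ℝ) = c * K := by rw [hmc, Nat.cast_mul]
  have e : t * (1 - t) * w 0 * c / (2 * (m : ℝ)) = t * (1 - t) * w 0 / (2 * K) := by rw [hmR]; field_simp
  rwa [e] at h

end UniformWarm

end Summit.Ventures.LatticeQCDFlow.Scaling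

end
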